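import Summits.QuantumFields.BalabanUV.T4Continuum.Support.CovariantLineTransporters
import Summits.QuantumFields.BalabanUV.T4Continuum.Support.RegularTransportersPerBond

/-!
# T⁴ programme, spine node NE2 (U1a) — row B5 FEED for the LINE presentation of B3: the regularity class (`RegularTransporters`, row B5)
# plus unitarity supply the per-bond laws of `CovariantLineTransporters` in the DEPTH-INDEPENDENT reading, with consistency budget `0` —
# so that reading's Gram summand closes from `(hreg, ‖R‖ ≤ 1)` ALONE, with NO node-NE3 input (tier B, support row B3.a-vec-bond, file 2)

NE2 formalisation swarm, seat `b2b-balaban-t4-ne2-formalise-leaf-02` (GEN 2), on top of this seat's `Support/CovariantLineTransporters` (p209932: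
`BondTowerLaws`, `lineTransportLaws_of_bonds`, the row-B3.a-vec ENDs `…_of_bonds`, and §6 `bondTowerLaws_of_levels` /
`covariantLineGram_rate_of_levels`) and leaf-03's `Support/RegularTransportersPerBond` (p208495: the per-bond size form
`norm_transporter_sub_one_le : ‖R^{(k)}_ν(x) − 1‖ ≤ α/L^k` of row B5's hypothesis structure `RegularBackgroundTower.RegularTransporters`).
 * `levelBonds R n b := R n ν(b) b` — the level-`n` transporter tower of `Support/ColourCovariantLaplacian`'s data type read PER BOND (own slot;
   for slot-independent data — the intended reading of an adjoint transporter — every slot gives the same matrix);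
 * **`bondTowerLaws_of_regular`**: `RegularTransporters L M R α β → (∀ k ν i, ‖R k ν i‖ ≤ 1) → BondTowerLaws L M (fun _ j => levelBonds R (j+1)) α
   (fun _ _ => 0)` — size from B5 BY NAME (`α/L^{j+1} = α·(L⁻¹)^{j+1}`, `cast_lev'`), consistency budget ZERO (depth-independent reading);
 * the ENDs BY NAME: **`perturbationLaws_covariantLineGram_of_regular_levels`** (THE ONE TARGET SHAPE for the summand
   `c·((Q^U_k)ᴴQ^U_k − Q_kᴴQ_k)` of the line presentation with LEVEL backgrounds) and **`covariantLineGram_rate_of_regular_levels`**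
   (`t = 1`, `c = a`): the η-rate under the DISPLAYED threshold `kappaLine d L a (ℓ·α·L⁻¹) α a < 1` on the REGULARITY CLASS ALONE and with
   NO `hNE3` binder at all; canonical contours `hΓ := length_stepContour_le` (`ℓ = d(L − 1)`).
WHAT THIS LOCATES (typed, no adjective): in the line-composite presentation of Bałaban's covariant averaging ([Balaban1985BackgroundPropagators]
(3.15) p.393 shape «Q_k(U) = Q(Ū^{(k−1)})⋯Q(U)») node NE3 is needed for EXACTLY ONE thing — replacing the `j`-fold AVERAGED backgrounds
`Ū^{(k−1−j)}_k` of the depth-`k` minimiser by the LEVEL backgrounds `U_{j+1}` (the budget `βb` of `BondTowerLaws.consistent`).  With level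
backgrounds the two-level consistency of the composite is automatic (the depth-`k+1` composite's first `k` steps ARE the depth-`k` composite;
only the finest step's size `α·L^{−k}` enters).  Contrast the (α) instance of record (REFEREE c8; leaf-07/06/03: `QcovLev (R k)` along NESTED
contours of the finest background only), where NE3 supplies the two-level law itself (`transport_contour_two_level_of_regular`).

HONEST FRAMING (T4-DAG p. 1).  Model level: transporters are DATA; unitarity `‖R‖ ≤ 1` and the regularity class are hypothesis SHAPES
(binders displayed); the depth-independent reading is NOT Bałaban's `Q_k(U_k(V))` and NOT the (α) instance that counts for ROOT B (c8) — no
identification asserted (c5); finite torus, linear layer, operator norm; constants OURS; NOT [B7] (124) or [B9] (3.15)/(3.26) as printed;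
NE2 NOT proved; NOT infinite volume / mass gap / Clay / summit progress; spine 0/9 unchanged.  HONEST DEPENDENCY: continuum YM on T⁴ ⇐
BetaPertH ∧ nine spine estimates (0/9 proved); BetaPertH ⇐ (D1) ∧ (D4) ∧ CAP+tail; G-an2-4 gates asym, D1 and NE2/3/4.  ABSOLUTE RULE kept;
no `sorry`.
-/

noncomputable section

open scoped BigOperators ComplexConjugate Matrix Matrix.Norms.L2Operator Kronecker

namespace Summit.QuantumFields.BalabanUV.T4Continuum.CovariantLineTransportersRegular

open Literature.MathematicalPhysics.QuantumFieldTheory.Balaban1983to89.B5Prop11Plancherel (fine Tor Cst)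
open Literature.MathematicalPhysics.QuantumFieldTheory.Balaban1983to89.B5G183RateUnitTower (lev lev_neZero)
open Summit.QuantumFields.BalabanUV.T4Continuum
open Summit.QuantumFields.BalabanUV.T4Continuum.BalabanAveragedTowerUnit (idx Qlev cast_lev')
open Summit.QuantumFields.BalabanUV.T4Continuum.BackgroundResolventTower
open Summit.QuantumFields.BalabanUV.T4Continuum.KingPairingPlantedLaw
open Summit.QuantumFields.BalabanUV.T4Continuum.CovariantAveragingTower (TowerLimitRate)
open Summit.QuantumFields.BalabanUV.T4Continuum.KroneckerLift
open Summit.QuantumFields.BalabanUV.T4Continuum.GramPerturbationLaw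
open Summit.QuantumFields.BalabanUV.T4Continuum.CompositeAveragingLaw
open Summit.QuantumFields.BalabanUV.T4Continuum.CovariantLineAveragingTower
open Summit.QuantumFields.BalabanUV.T4Continuum.CovariantLineTransporters
open Summit.QuantumFields.BalabanUV.T4Continuum.RegularBackgroundTower (RegularTransporters)
open Summit.QuantumFields.BalabanUV.T4Continuum.RegularTransportersPerBond (norm_transporter_sub_one_le)

variable {d : ℕ} (L : ℕ) [NeZero L] (M : Fin d → ℕ) [hM : ∀ μ, NeZero (M μ)] {o : Type*} [Fintype o] [DecidableEq o]

/-- the level-`n` transporter tower read PER BOND in its own slot: `levelBonds R n (x, ν) = R^{(n)}_ν(x, ν)`. [folklore] -/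
def levelBonds (R : (k : ℕ) → Fin d → (idx L M k → Matrix o o ℂ)) (n : ℕ) (b : idx L M n) : Matrix o o ℂ := R n b.2 b

omit hM in
/-- the per-bond size of the level towers in the currency of `BondTowerLaws`: `‖R^{(n)}_ν(b) − 1‖ ≤ α·(L⁻¹)^n` (row B5's
`norm_transporter_sub_one_le`, `L^n` recast by `cast_lev'`). [folklore] -/
theorem norm_levelBonds_sub_one_le {R : (k : ℕ) → Fin d → (idx L M k → Matrix o o ℂ)} {α β : ℝ} (hreg : RegularTransporters L M R α β)
    (n : ℕ) (b : idx L M n) : ‖levelBonds L M R n b - 1‖ ≤ α * ((L : ℝ)⁻¹) ^ n := by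
  have h := norm_transporter_sub_one_le hreg n b.2 b
  rwa [cast_lev', div_eq_mul_inv, ← inv_pow] at h

omit hM in
/-- **ROW B5 FEEDS THE PER-BOND LAWS (depth-independent reading)**: the regularity class gives the size `α·(L⁻¹)^{j+1}` of the level-`(j+1)`
bonds (`RegularTransportersPerBond.norm_transporter_sub_one_le`), unitarity gives the contractions, and the consistency budget is `0`.
[folklore] -/
theorem bondTowerLaws_of_regular {R : (k : ℕ) → Fin d → (idx L M k → Matrix o o ℂ)} {α β : ℝ} (hreg : RegularTransporters L M R α β)
    (hR1 : ∀ k ν (i : idx L M k), ‖R k ν i‖ ≤ 1) :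
    BondTowerLaws L M (fun _ j => levelBonds L M R (j + 1)) α (fun _ _ => 0) :=
  bondTowerLaws_of_levels L M hreg.nonneg.1 (fun n b => hR1 n b.2 b) (norm_levelBonds_sub_one_le L M hreg)

variable (a : ℝ) (ha : 0 < a) {Γ : StepContours L M} {ℓ : ℕ}

/-- **THE ONE TARGET SHAPE FOR THE LINE PRESENTATION WITH LEVEL BACKGROUNDS, FROM THE REGULARITY CLASS AND UNITARITY ALONE** (`L ≥ 2`):
`PerturbationLaws (Δ_a ⊗ 1) (c·((Q^U)ᴴQ^U − QᴴQ)) (J ⊗ 1) κ_Q e₂`, `κ_Q = kappaLine d L a (ℓαL⁻¹) α c`; NO node-NE3 binder (the consistency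
budget inside `deltaComp` is the zero sum). [cite: Balaban1985BackgroundPropagators, (3.26) p.395 (where `Q*(U)aQ(U)` enters), (3.35)–(3.36)
p.396 (shape of `hreg`)] [folklore] -/
theorem perturbationLaws_covariantLineGram_of_regular_levels (hL : 2 ≤ L) (hΓ : ∀ j x, (Γ j x).length ≤ ℓ)
    {R : (k : ℕ) → Fin d → (idx L M k → Matrix o o ℂ)} {α β : ℝ} (hreg : RegularTransporters L M R α β)
    (hR1 : ∀ k ν (i : idx L M k), ‖R k ν i‖ ≤ 1) (c : ℂ) :
    PerturbationLaws (fun k => calDalev L M a ha k ⊗ₖ (1 : Matrix o o ℂ))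
      (gramPert c (Bref L M) (Eline L M (Tb L M Γ (fun _ j => levelBonds L M R (j + 1))) (Rlb L M (fun _ j => levelBonds L M R (j + 1)))))
      (fun k => JpcT L M k ⊗ₖ (1 : Matrix o o ℂ)) (kappaLine d L a (ℓ * α * (L : ℝ)⁻¹) α c)
      (fun k => ‖c‖ * e2gram (Cst d a) 1 (epsComp (ℓ * α * (L : ℝ)⁻¹ + α) ((L : ℝ)⁻¹)) (fun k => 2 * d * Cst d a * ((L : ℝ)⁻¹) ^ k)
        (fun k => CJ d a * ((L : ℝ)⁻¹) ^ k) (fun k => d * L * Cst d a * ((L : ℝ)⁻¹) ^ k)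
        (deltaComp (Cst d a) (ℓ * α * (L : ℝ)⁻¹ + α) ((L : ℝ)⁻¹) (fun k => d * L * Cst d a * ((L : ℝ)⁻¹) ^ k)
          (fun k => ∑ _j ∈ Finset.range k, 2 * ((ℓ + L) * (0 : ℝ)))) k) :=
  perturbationLaws_covariantLineGram_of_bonds L M a ha hL hΓ (bondTowerLaws_of_regular L M hreg hR1) c

/-- **η-RATE OF THE COVARIANT-AVERAGING GRAM SUMMAND (LINE PRESENTATION, LEVEL BACKGROUNDS) UNDER A THRESHOLD ON THE REGULARITY CLASS
ALONE, NO NE3** (`L ≥ 2`, `t = 1`, `c = a`): if `kappaLine d L a (ℓαL⁻¹) α a < 1` the King-averaged unit-lattice covariances of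
`(Δ_a^{(k)} ⊗ 1 + a·((Q^U_k)ᴴQ^U_k − Q_kᴴQ_k))⁻¹` converge with rate `L^{−k}` (`Ccs = 0`).  Binders: `hreg` (row B5), `hR1` (unitarity).
NOT the (α) instance of ROOT B; NE2 NOT proved. [cite: King1986, Lemma 4.5 (4.32)/(4.38) p.674 (scalar template)] [folklore] -/
theorem covariantLineGram_rate_of_regular_levels (hL : 2 ≤ L) (hΓ : ∀ j x, (Γ j x).length ≤ ℓ)
    {R : (k : ℕ) → Fin d → (idx L M k → Matrix o o ℂ)} {α β : ℝ} (hreg : RegularTransporters L M R α β)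
    (hR1 : ∀ k ν (i : idx L M k), ‖R k ν i‖ ≤ 1) (hsmall : kappaLine d L a (ℓ * α * (L : ℝ)⁻¹) α (a : ℂ) < 1) :
    TowerLimitRate (fun k => Qlev L M k ⊗ₖ (1 : Matrix o o ℂ)) ((L : ℝ) ^ d)
      (fun k => (calDalev L M a ha k ⊗ₖ (1 : Matrix o o ℂ)
        + gramPert (a : ℂ) (Bref L M) (Eline L M (Tb L M Γ (fun _ j => levelBonds L M R (j + 1)))
            (Rlb L M (fun _ j => levelBonds L M R (j + 1)))) k)⁻¹)
      (Cpert (kappaLine d L a (ℓ * α * (L : ℝ)⁻¹) α (a : ℂ)) (2 * d * Cst d a) (CJ d a)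
        (C2line d L a (ℓ * α * (L : ℝ)⁻¹) α 0 (a : ℂ)) 0 1) ((L : ℝ)⁻¹) :=
  covariantLineGram_rate_of_levels L M a ha hL hΓ hreg.nonneg.1 (fun n b => hR1 n b.2 b) (norm_levelBonds_sub_one_le L M hreg) hsmall

/-- the canonical-contour instance (`ℓ = d(L − 1)`): threshold `kappaLine d L a (d(L−1)·α·L⁻¹) α a < 1`. [folklore] -/
theorem covariantLineGram_rate_of_regular_levels_step (hL : 2 ≤ L) {R : (k : ℕ) → Fin d → (idx L M k → Matrix o o ℂ)} {α β : ℝ}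
    (hreg : RegularTransporters L M R α β) (hR1 : ∀ k ν (i : idx L M k), ‖R k ν i‖ ≤ 1)
    (hsmall : kappaLine d L a (((d * (L - 1) : ℕ) : ℝ) * α * (L : ℝ)⁻¹) α (a : ℂ) < 1) :
    TowerLimitRate (fun k => Qlev L M k ⊗ₖ (1 : Matrix o o ℂ)) ((L : ℝ) ^ d)
      (fun k => (calDalev L M a ha k ⊗ₖ (1 : Matrix o o ℂ)
        + gramPert (a : ℂ) (Bref L M) (Eline L M (Tb L M (stepContour L M) (fun _ j => levelBonds L M R (j + 1)))
            (Rlb L M (fun _ j => levelBonds L M R (j + 1)))) k)⁻¹)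
      (Cpert (kappaLine d L a (((d * (L - 1) : ℕ) : ℝ) * α * (L : ℝ)⁻¹) α (a : ℂ)) (2 * d * Cst d a) (CJ d a)
        (C2line d L a (((d * (L - 1) : ℕ) : ℝ) * α * (L : ℝ)⁻¹) α 0 (a : ℂ)) 0 1) ((L : ℝ)⁻¹) :=
  covariantLineGram_rate_of_regular_levels L M a ha hL (length_stepContour_le L M) hreg hR1 hsmall

end Summit.QuantumFields.BalabanUV.T4Continuum.CovariantLineTransportersRegular

end
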